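import Literature.AlgebraicGeometry.Resolution.WeightedCentreTruncation
import HarnessLib

/-!
# (P) is inherited by a killed bottom segment (instrument, NOT a resolution theorem)

Engine 1 of the RESOLUTION OBSERVATORY toy model `W(f)` — CARVER-NOTES-eng1-g41 **T82 (iv)** (LEMMA KL, RE-DERIVATION-eng1-g41 §3.1, the one
clause "with content"): if `Z` is a bottom segment of slots (every `z ∈ Z` strictly lighter than every `x ∉ Z`) then the pin condition (P) at a
kept slot passes from `G` to the killed face `Ḡ = kill_Z G` — "extend a graded automorphism of the smaller ring by the identity on `Z`; pins of
`x ∉ Z` contain no `Z`-variable (weights), so they are read off after killing `Z`".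

In the tree's formalism (`WeightedCentreTruncation`: `killLight (c ≤ w ·)` kills the slots of weight `< c`; `IsPinnedIn w l F := l ∈ vars
(killLight (w l ≤ w ·) F)`; `SlotPinned w l g` = `X_l` pinned in `Φ g` for EVERY graded automorphism pair of the whole ring, which by
`liftHom` / `slotPinned_iff_bottomPinned` represents the automorphisms of every truncation) the statement is, for a threshold `c ≤ w l`:

* `killLight_killLight_of_imp` — nested kills: killing a smaller kept-set after (or before) a larger one is the smaller kill;
* `isPinnedIn_apply_killLight_iff` — for graded `Φ`, `X_l` is pinned in `Φ (kill_{<c} g)` iff it is pinned in `Φ g` (`0 < w l`, no weight-`0`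
  slot below `w l`): the pin at `l` only sees the truncation at `w l ≥ c` (`killLight_apply_of_isGraded`);
* `slotPinned_killLight_iff` — hence **(P) at `l` for `kill_{<c} g` ⇔ (P) at `l` for `g`**, and the system form `forall_slotPinned_killLight`
  (T82 (iv): (P) at every kept slot is inherited by the killed face).

References: weighted gradings [AbramovichTemkinWlodarczyk2024, §5.1 (p. 1575)]; substitutions [Lang2002, Ch. IV §1].  Statements engine 1's,
formalisation OURS; nothing here is about resolution of singularities.
-/

open MvPolynomial

namespace Literature.AlgebraicGeometry.Resolution.WeightedBlowup

namespace Truncation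

variable {S : Type*} [CommRing S] {ι : Type*}

section Nested

variable (H H' : ι → Prop) [DecidablePred H] [DecidablePred H']

/-- **Nested kills** (ours, bookkeeping): if the kept-set `H'` is contained in the kept-set `H`, then killing with `H` and then with `H'` is
killing with `H'`. [cite: Lang2002, Ch. IV §1] -/
theorem killLight_killLight_of_imp (hHH' : ∀ i, H' i → H i) (F : MvPolynomial ι S) :
    killLight H' (killLight H F) = killLight H' F := by
  have key : (killLight (S := S) H').comp (killLight H) = killLight H' := by
    refine MvPolynomial.algHom_ext fun i => ?_
    rw [AlgHom.comp_apply, killLight_X, heavyX]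
    split_ifs with hi
    · rfl
    · rw [map_zero, killLight_X, heavyX, if_neg fun h => hi (hHH' i h)]
  exact congrArg (fun φ : MvPolynomial ι S →ₐ[S] MvPolynomial ι S => φ F) key

/-- **Nested kills, the other order** (ours, bookkeeping): killing with the smaller kept-set `H'` first and then with `H ⊇ H'` is again
killing with `H'`. [cite: Lang2002, Ch. IV §1] -/
theorem killLight_killLight_of_imp' (hHH' : ∀ i, H' i → H i) (F : MvPolynomial ι S) :
    killLight H (killLight H' F) = killLight H' F := by
  have key : (killLight (S := S) H).comp (killLight H') = killLight H' := by
    refine MvPolynomial.algHom_ext fun i => ?_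
    rw [AlgHom.comp_apply, killLight_X, heavyX]
    split_ifs with hi
    · rw [killLight_X, heavyX, if_pos (hHH' i hi)]
    · rw [map_zero]
  exact congrArg (fun φ : MvPolynomial ι S →ₐ[S] MvPolynomial ι S => φ F) key

end Nested

section KillPin

variable (w : ι → ℚ)

/-- Nested weight thresholds (ours, bookkeeping): for `c ≤ c'`, `kill_{<c'} ∘ kill_{<c} = kill_{<c'}`. [cite: AbramovichTemkinWlodarczyk2024, §5.1 (p. 1575)] -/
theorem killLight_killLight_of_le {c c' : ℚ} (hcc' : c ≤ c') (F : MvPolynomial ι S) :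
    killLight (fun j => c' ≤ w j) (killLight (fun j => c ≤ w j) F) = killLight (fun j => c' ≤ w j) F :=
  killLight_killLight_of_imp _ _ (fun _ hi => hcc'.trans hi) F

/-- **The pin at a kept slot does not see the killed segment** (ours; T82 (iv) core): for a graded endomorphism `Φ`, a slot `l` with `0 < w l`
and no weight-`0` slot below it, and a threshold `c ≤ w l`, `X_l` is pinned in `Φ (kill_{<c} g)` iff it is pinned in `Φ g`.
[cite: AbramovichTemkinWlodarczyk2024, §5.1 (p. 1575)] -/
theorem isPinnedIn_apply_killLight_iff {l : ι} (hl : 0 < w l) (hw : ∀ i, w i < w l → w i ≠ 0) {c : ℚ} (hc : c ≤ w l)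
    {Φ : MvPolynomial ι S →ₐ[S] MvPolynomial ι S} (hΦ : IsGraded w Φ) (g : MvPolynomial ι S) :
    IsPinnedIn w l (Φ (killLight (fun j => c ≤ w j) g)) ↔ IsPinnedIn w l (Φ g) := by
  unfold IsPinnedIn
  rw [killLight_apply_of_isGraded w (w l) hl hw hΦ, killLight_apply_of_isGraded w (w l) hl hw hΦ, killLight_killLight_of_le w hc]

/-- **T82 (iv): (P) at a kept slot is inherited by the killed face, and conversely** (ours): for `c ≤ w l` (`0 < w l`, no weight-`0` slot below
`w l`), `SlotPinned w l (kill_{<c} g) ↔ SlotPinned w l g`. [cite: AbramovichTemkinWlodarczyk2024, §5.1 (p. 1575)] -/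
theorem slotPinned_killLight_iff {l : ι} (hl : 0 < w l) (hw : ∀ i, w i < w l → w i ≠ 0) {c : ℚ} (hc : c ≤ w l)
    (g : MvPolynomial ι S) : SlotPinned w l (killLight (fun j => c ≤ w j) g) ↔ SlotPinned w l g := by
  constructor
  · intro h Φ Φ' hp
    exact (isPinnedIn_apply_killLight_iff w hl hw hc hp.1 g).mp (h Φ Φ' hp)
  · intro h Φ Φ' hp
    exact (isPinnedIn_apply_killLight_iff w hl hw hc hp.1 g).mpr (h Φ Φ' hp)

/-- **T82 (iv), system form** (ours): if every kept slot (weight `≥ c`, with `0 < c` and no weight-`0` slot) is (P)-pinned in `g`, then every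
kept slot is (P)-pinned in the killed face `kill_{<c} g`. [cite: AbramovichTemkinWlodarczyk2024, §5.1 (p. 1575)] -/
theorem forall_slotPinned_killLight {c : ℚ} (hc : 0 < c) (hw : ∀ i, w i ≠ 0) {g : MvPolynomial ι S}
    (hP : ∀ l, c ≤ w l → SlotPinned w l g) : ∀ l, c ≤ w l → SlotPinned w l (killLight (fun j => c ≤ w j) g) :=
  fun l hl => (slotPinned_killLight_iff w (hc.trans_le hl) (fun i _ => hw i) hl g).mpr (hP l hl)

/-- The same with a pin threshold `η` (ours; engine 1's "(P) with threshold `η`": only slots of weight `> η` are required to be pinned):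
(P)_{>η} for `g` ⇒ (P)_{>η} at the kept slots for `kill_{<c} g`. [cite: AbramovichTemkinWlodarczyk2024, §5.1 (p. 1575)] -/
theorem forall_slotPinned_killLight_of_threshold {c η : ℚ} (hc : 0 < c) (hw : ∀ i, w i ≠ 0) {g : MvPolynomial ι S}
    (hP : ∀ l, η < w l → SlotPinned w l g) :
    ∀ l, c ≤ w l → η < w l → SlotPinned w l (killLight (fun j => c ≤ w j) g) :=
  fun l hl hη => (slotPinned_killLight_iff w (hc.trans_le hl) (fun i _ => hw i) hl g).mpr (hP l hη)

end KillPin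

end Truncation

end Literature.AlgebraicGeometry.Resolution.WeightedBlowup
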